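import Summits.QuantumFields.BalabanUV.T4Continuum.Support.ShellMeasureLiveEndOneCallSlot
import Summits.QuantumFields.BalabanUV.T4Continuum.Support.ShellMeasureRootCompositionSync

/-!
# `T4Continuum.ShellMeasureLiveEndOneCall` — row S92 file 2 «THE ONE CALL AT THE LIVE LEVELS»: END-I ∘ END-II-final IN ONE
# DECLARATION — `ShellWeightBound` ⇐ THE NAMED BINDERS (WALL §2b's rows over BOTH runs + END-I's own rows, nothing else)
(cell `pub-balaban`, sub-cell `t4`, NE7c (node U5b); crew unit `b2b-balaban-t4-ne7c-formalise-leaf-09` gen 12; owner table row **S92**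
(R-ne7cp1-g33-3 (b); CLAIM l.18910, SHAPE∕Q l.18955); imports file 1 `ShellMeasureLiveEndOneCallSlot` + S27 `ShellMeasureRootCompositionSync`
ONLY; [folklore]; 0 `def`, 0 `def … : Prop`, 0 sorry, 0 citation tags; statement generated by the same script as file 1)

HONEST FRAMING.  Finite four-torus programme, rung (B)+1 only — NOT infinite volume, NOT a mass gap, NOT the Clay problem, NOT
summit progress; (B), `BetaPertHyp`, (B^μ) not consumed.  NE7c (`T4IndicatorShell.ShellWeightBound`) is NOT PRINTED in
[Balaban 1983–89] and NOT PROVED; «NE7c ⇐ the named binders» (trigger c3): every binder below is DISPLAYED, asserted by nobody;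
no estimate of Bałaban's is discharged; (M1) realized ≠ NE7c.  Equation numbers in comments LOCATE displayed shapes, not
citations.  HONEST DEPENDENCY (cell): continuum YM on T⁴ ⇐ BetaPertH ∧ nine spine estimates (0/9 proved); BetaPertH ⇐ (D1) ∧ (D4)
∧ CAP+tail; G-an2-4 gates asym, D1 and NE2/3/4.
THIS declaration IS the countdown's object at the live levels; landing it moves NOTHING by itself — every row stays displayed.

WHAT IS PROVED ([folklore]).  **`shellWeightBound_live_oneCall`** := END-I S27 `shellWeightBound_of_towerData_sync` (G := SU2; run `r`'s
slot `s` of comparison `K` on `(P r K s, jl r K s)`; the scheme∕age reading `…_of_schemeData_age` is the instance `P true K s = Psch K`,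
`jl true = lvl true`, `P false K s = Psch (K+1)`, `jl false K s = lvl false K s + 1`; thresholds BY AGE `ε r (K − lvl r K s)`) with
`hacA`∕`hacB` DISCHARGED by file 1 `hac_live_of_assembled_decay` (S80 f3 ∘ S90) at `r := true ∕ false`.  Binders: file 1's
`(r, K, t, s)`-families of EVERY S80 f3 binder VERBATIM; the slot→level majorant `hDslot` (S80 f3's constant written ONCE); END-I's
rows VERBATIM ((R)+[dict] per run with the NORMALISED variables `u ∕ η²` in the shell events, finiteness, `LiveWindow` ×2 (SM-L7),
`0 < ϑ < 1`, `D ≤ D̄`, rates (SM-L8, U1b BY NAME)).  CONCLUSION LITERALLY `ShellWeightBound l₀ T A B shA shB (fun K => Σ_{s∈Sl true K}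
D true (lvl true K s)·ρ true (lvl true K s) + Σ_{s∈Sl false K} …)`.  Tests: (t1) ✓; (t2) NO `SlotAntiConcentration` hypothesis;
(t3) WALL rows × both runs (one `Bool`-family each) + END-I (g)–(k), 0 `def … : Prop`; (t4) trio; (x1) = S88 `ShellMeasureLandauEndFinalToy`.
-/

noncomputable section

open Set Metric NormedSpace MeasureTheory Function Finset
open scoped ENNReal

namespace Summit.QuantumFields.BalabanUV.T4Continuum.ShellMeasureLiveEndOneCall

open Literature.MathematicalPhysics.QuantumFieldTheory.Balaban1983to89
open B11Prop6Scheme (Prop4Hyp)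
open GaugeField (GaugeInvariant)
open T4ShellMeasure (SlotAntiConcentration)
open T4CubePoincare (cube)
open T4CubeChartGnomonic (SU2)
open T4CubeChartExp (expFibreChart)
open T4TreeGaugeFixing (NoClosedLoop fixTo)
open T4ShellMeasurePlaquette (expTail₂)
open ShellMeasureLevelAssembly (classifier)
open ShellMeasureMultiGridNorms (WSup)
open ShellMeasurePinnedNorm (pinW)
open ShellMeasureDecayKernelSums (kerOp)
open ShellMeasureLandauHolonomy (solAt landauExp)
open ShellMeasureLandauHolonomyChart (holOf cplx)
open ShellMeasureLandauHolonomySkew (readOutReal)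
open T4IndicatorShell (ShellWeightBound)
open T4ShellMeasureLevels (LiveWindow)
open ShellMeasureRootCompositionSync (shellWeightBound_of_towerData_sync)
open ShellMeasureLiveEndOneCallSlot (hac_live_of_assembled_decay)

open scoped Matrix.Norms.L2Operator

variable {σ : Type*} {n : Type*} [Fintype n] [DecidableEq n] [Nonempty n]

/-- **`ShellWeightBound` ⇐ THE NAMED BINDERS, AT THE LIVE LEVELS, IN ONE DECLARATION** (row S92; see the module docstring).
CONDITIONAL on every displayed binder; nothing PRINTED is asserted; NOT Bałaban's minimiser; NOT NE7c proved — NE7c ⇐ these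
binders. [folklore] -/
theorem shellWeightBound_live_oneCall
    (P : Bool → ℕ → σ → Params) (jl lvl : Bool → ℕ → σ → ℕ) [∀ r K s, DecidableEq (PBond (P r K s) (jl r K s))]
    {ε η ρ β D : Bool → ℕ → ℝ} (hη : ∀ r j, 0 < η r j) (hε : ∀ r a, 0 < ε r a) (hρ0 : ∀ r j, 0 ≤ ρ r j) (hD0 : ∀ r j, 0 ≤ D r j)
    (Sl : Bool → ℕ → Finset σ) {l₀ : ℝ}
    -- EVERY END-II binder of S80 f3 as an (r, K, t, s)-family — file 1's list VERBATIM (its section comments there)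
    {𝒴 𝒴' 𝒳 𝒵 ℬ : Bool → ℕ → σ → Type*} [∀ r K s, NormedAddCommGroup (𝒴 r K s)] [∀ r K s, NormedSpace ℂ (𝒴 r K s)]
    [∀ r K s, CompleteSpace (𝒴 r K s)] [∀ r K s, NormedAddCommGroup (𝒴' r K s)] [∀ r K s, NormedSpace ℂ (𝒴' r K s)]
    [∀ r K s, NormedAddCommGroup (𝒳 r K s)] [∀ r K s, NormedSpace ℂ (𝒳 r K s)] [∀ r K s, CompleteSpace (𝒳 r K s)]
    [∀ r K s, NormedAddCommGroup (𝒵 r K s)] [∀ r K s, NormedSpace ℂ (𝒵 r K s)] [∀ r K s, NormedAddCommGroup (ℬ r K s)]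
    [∀ r K s, NormedSpace ℂ (ℬ r K s)] {Tr : ∀ r K s, Finset (PBond (P r K s) (jl r K s))}
    (hT : ∀ r K s, NoClosedLoop (Tr r K s)) (U₀ : ∀ r K (t : ℝ) s, GaugeField (P r K s) (jl r K s) SU2)
    (Λ : ∀ r K s, Finset (PBond (P r K s) (jl r K s))) {m₀ : Bool → ℕ → σ → ℕ}
    (e : ∀ r K s, ↥(Λ r K s) × Fin 3 ≃ Fin (m₀ r K s)) {S : ℝ} (hS : 0 < S) (hSπ : 3 * S ^ 2 < Real.pi ^ 2)
    (ctr : ∀ r K (t : ℝ) s, GaugeField (P r K s) (jl r K s) SU2 → GaugeField (P r K s) (jl r K s) SU2)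
    {F : ∀ r K (t : ℝ) s, GaugeField (P r K s) (jl r K s) SU2 → ℝ≥0∞} (hF : ∀ r K t s, Measurable (F r K t s))
    (hFi : ∀ r K t s, GaugeInvariant (F r K t s))
    (hFsupp : ∀ r K t s, ∀ V y, F r K t s (fixTo (Tr r K s) (U₀ r K t s) (updateFinset V (Λ r K s) y)) ≠ 0 → ∀ b (hb : b ∈ Λ r K
      s), dist1 ((ctr r K t s V b)⁻¹ * y ⟨b, hb⟩) ≤ 2 * Real.sin (S / 2))
    {u : ∀ r K (t : ℝ) s, GaugeField (P r K s) (jl r K s) SU2 → ℝ} (hu : ∀ r K t s, Measurable (u r K t s))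
    (hui : ∀ r K t s, GaugeInvariant (u r K t s)) {ιc : Bool → ℕ → σ → Type*} {Pu : ∀ r K (t : ℝ) s, Finset (ιc r K s)}
    (hPu : ∀ r K t s, (Pu r K t s).Nonempty)
    (W : ∀ r K (t : ℝ) s, GaugeField (P r K s) (jl r K s) SU2 → Set (Fin (m₀ r K s) → ℝ))
    (Jco : ∀ r K (t : ℝ) s, GaugeField (P r K s) (jl r K s) SU2 → (Fin (m₀ r K s) → ℝ) → ℝ≥0∞) {δ : ℝ}
    (𝒢 : ∀ r K (t : ℝ) s, GaugeField (P r K s) (jl r K s) SU2 → (𝒵 r K s →L[ℂ] (𝒴 r K s)))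
    (W𝒱 : ∀ r K (t : ℝ) s, GaugeField (P r K s) (jl r K s) SU2 → 𝒴 r K s → 𝒵 r K s) {B₀ C₄ a₃ ε₄ : ℝ}
    (h𝒢 : ∀ r K t s, ∀ V f, ‖𝒢 r K t s V f‖ ≤ B₀ * ‖f‖) (hW : ∀ r K t s, ∀ V, Prop4Hyp (W𝒱 r K t s V) C₄ a₃) (hB₀ : 0 < B₀)
    (hC₄ : 0 ≤ C₄) (hε₄ : 0 ≤ ε₄) {dL C₁ B₃ ε₁ : ℝ} (hdL : 0 ≤ dL) (hC₁ : 0 ≤ C₁) (hε₁ : 0 ≤ ε₁) (hB₃ : dL ≤ B₃)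
    (h1 : 2 * B₀ * C₁ * B₃ * ε₁ ≤ ε₄) (h2 : 4 * ε₄ ≤ a₃) (h3 : 16 * B₀ * C₄ * ε₄ ≤ 1)
    (H₁ : ∀ r K (t : ℝ) s, GaugeField (P r K s) (jl r K s) SU2 → (ℬ r K s →L[ℂ] (𝒴 r K s)))
    (hH₁ : ∀ r K t s, ∀ V B, ‖H₁ r K t s V B‖ ≤ B₀ * ‖B‖)
    (Φ : ∀ r K (t : ℝ) s, GaugeField (P r K s) (jl r K s) SU2 → (Fin (m₀ r K s) → ℂ) → ℬ r K s) {rΦ : ℝ}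
    (hΦd : ∀ r K t s, ∀ V, DifferentiableOn ℂ (Φ r K t s V) (ball 0 rΦ)) (hΦ0 : ∀ r K t s, ∀ V, Φ r K t s V 0 = 0)
    (hΦ : ∀ r K t s, ∀ V, ∀ z ∈ ball (0 : Fin (m₀ r K s) → ℂ) rΦ, ‖Φ r K t s V z‖ < 2 * dL * C₁ * ε₁) (hSr : S < rΦ)
    (Cf : ∀ r K (t : ℝ) s, GaugeField (P r K s) (jl r K s) SU2 → 𝒴' r K s → 𝒳 r K s) {C₂ RC : ℝ} (hC₂ : 0 ≤ C₂)
    (hCq : ∀ r K t s, ∀ V, ∀ Z : 𝒴' r K s, ‖Z‖ < RC → ‖Cf r K t s V Z‖ ≤ C₂ * ‖Z‖ ^ 2)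
    (hCd : ∀ r K t s, ∀ V, DifferentiableOn ℂ (Cf r K t s V) (ball 0 RC))
    (ιs : ∀ r K (t : ℝ) s, GaugeField (P r K s) (jl r K s) SU2 → (𝒴 r K s →L[ℂ] (𝒴' r K s)))
    (hι : ∀ r K t s, ∀ V Y, ‖ιs r K t s V Y‖ ≤ ‖Y‖)
    (Hop : ∀ r K (t : ℝ) s, GaugeField (P r K s) (jl r K s) SU2 → (𝒳 r K s →L[ℂ] (𝒴 r K s)))
    (hH : ∀ r K t s, ∀ V X, ‖Hop r K t s V X‖ ≤ B₀ * ‖X‖) {ε₃ : ℝ} (h18 : 18 * C₂ * B₀ * ε₃ ≤ 1)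
    (hcoup : ε₄ + B₀ * (2 * dL * C₁ * ε₁) ≤ ε₃) (h3R : 3 * ε₃ ≤ RC)
    (ℓs : ∀ r K (t : ℝ) s, ιc r K s → List (𝒴 r K s →L[ℂ] Matrix n n ℂ)) {κr : ℝ} (hκ : 0 ≤ κr)
    (hℓ : ∀ r K t s, ∀ p ∈ Pu r K t s, ∀ ℓ ∈ ℓs r K t s p, ∀ Y, ‖ℓ Y‖ ≤ κr * ‖Y‖) {m : ℕ}
    (hlen : ∀ r K t s, ∀ p ∈ Pu r K t s, (ℓs r K t s p).length ≤ m) {κc : ℝ} (hκc : 0 ≤ κc)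
    (hcurl : ∀ r K t s, ∀ p ∈ Pu r K t s, ∀ Y, ‖((ℓs r K t s p).map fun ℓ => ℓ Y).sum‖ ≤ κc * ‖Y‖)
    {Λw Λz Λw' Λx Λb 𝔖 : Bool → ℕ → σ → Type*} [∀ r K s, Fintype (Λw r K s)] [∀ r K s, DecidableEq (Λw r K s)]
    [∀ r K s, Fintype (Λz r K s)] [∀ r K s, Fintype (Λw' r K s)] [∀ r K s, Fintype (Λx r K s)] [∀ r K s, Fintype (Λb r K s)]
    {𝔄w ℭ 𝔄' 𝔅 𝔇 : Bool → ℕ → σ → Type*} [∀ r K s, NormedAddCommGroup (𝔄w r K s)] [∀ r K s, NormedSpace ℂ (𝔄w r K s)]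
    [∀ r K s, CompleteSpace (𝔄w r K s)] [∀ r K s, NormedAddCommGroup (ℭ r K s)] [∀ r K s, NormedSpace ℂ (ℭ r K s)]
    [∀ r K s, NormedAddCommGroup (𝔄' r K s)] [∀ r K s, NormedSpace ℂ (𝔄' r K s)] [∀ r K s, NormedAddCommGroup (𝔅 r K s)]
    [∀ r K s, NormedSpace ℂ (𝔅 r K s)] [∀ r K s, CompleteSpace (𝔅 r K s)] [∀ r K s, NormedAddCommGroup (𝔇 r K s)]
    [∀ r K s, NormedSpace ℂ (𝔇 r K s)] {δw : ℝ} (hδw : 0 ≤ δw) (ϖw : ∀ r K (t : ℝ) s, 𝔖 r K s → ℝ)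
    (dis : ∀ r K (t : ℝ) s, 𝔖 r K s → 𝔖 r K s → ℝ) (hϖw : ∀ r K t s, ∀ x y, ϖw r K t s x ≤ ϖw r K t s y + dis r K t s x y)
    (pos : ∀ r K (t : ℝ) s, Λw r K s → 𝔖 r K s) (posz : ∀ r K (t : ℝ) s, Λz r K s → 𝔖 r K s)
    (pos' : ∀ r K (t : ℝ) s, Λw' r K s → 𝔖 r K s) (posx : ∀ r K (t : ℝ) s, Λx r K s → 𝔖 r K s)
    (posb : ∀ r K (t : ℝ) s, Λb r K s → 𝔖 r K s)
    (k𝒢 : ∀ r K (t : ℝ) s, GaugeField (P r K s) (jl r K s) SU2 → Λw r K s → Λz r K s → (ℭ r K s →L[ℂ] (𝔄w r K s)))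
    (kι : ∀ r K (t : ℝ) s, GaugeField (P r K s) (jl r K s) SU2 → Λw' r K s → Λw r K s → (𝔄w r K s →L[ℂ] (𝔄' r K s)))
    (kH : ∀ r K (t : ℝ) s, GaugeField (P r K s) (jl r K s) SU2 → Λw r K s → Λx r K s → (𝔅 r K s →L[ℂ] (𝔄w r K s)))
    (kH₁ : ∀ r K (t : ℝ) s, GaugeField (P r K s) (jl r K s) SU2 → Λw r K s → Λb r K s → (𝔇 r K s →L[ℂ] (𝔄w r K s)))
    {c𝒢 δ𝒢 M𝒢 cι δι Mι cH δH MH cH₁ δH₁ MH₁ : ℝ} (hc𝒢 : 0 ≤ c𝒢) (hM𝒢 : 0 ≤ M𝒢)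
    (hk𝒢 : ∀ r K t s, ∀ V c b', ‖k𝒢 r K t s V c b'‖ ≤ c𝒢 * Real.exp (-(δ𝒢 * dis r K t s (pos r K t s c) (posz r K t s b'))))
    (hM𝒢' : ∀ r K t s, ∀ x, ∑ b', Real.exp (-((δ𝒢 - δw) * dis r K t s x (posz r K t s b'))) ≤ M𝒢) (hcι : 0 ≤ cι) (hMι : 0 ≤ Mι)
    (hkι : ∀ r K t s, ∀ V c b', ‖kι r K t s V c b'‖ ≤ cι * Real.exp (-(δι * dis r K t s (pos' r K t s c) (pos r K t s b'))))
    (hMι' : ∀ r K t s, ∀ x, ∑ b', Real.exp (-((δι - δw) * dis r K t s x (pos r K t s b'))) ≤ Mι) (hcH : 0 ≤ cH) (hMH : 0 ≤ MH)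
    (hkH : ∀ r K t s, ∀ V c b', ‖kH r K t s V c b'‖ ≤ cH * Real.exp (-(δH * dis r K t s (pos r K t s c) (posx r K t s b'))))
    (hMH' : ∀ r K t s, ∀ x, ∑ b', Real.exp (-((δH - δw) * dis r K t s x (posx r K t s b'))) ≤ MH) (hcH₁ : 0 ≤ cH₁)
    (hMH₁ : 0 ≤ MH₁)
    (hkH₁ : ∀ r K t s, ∀ V c b', ‖kH₁ r K t s V c b'‖ ≤ cH₁ * Real.exp (-(δH₁ * dis r K t s (pos r K t s c) (posb r K t s b'))))
    (hMH₁' : ∀ r K t s, ∀ x, ∑ b', Real.exp (-((δH₁ - δw) * dis r K t s x (posb r K t s b'))) ≤ MH₁)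
    (W𝒱w : ∀ r K (t : ℝ) s, GaugeField (P r K s) (jl r K s) SU2 → (Λw r K s → 𝔄w r K s) → (Λz r K s → ℭ r K s))
    {B₀w C₄w a₃w ε₄w bw : ℝ} (h𝒢w : ∀ r K t s, ∀ V f, ‖kerOp (k𝒢 r K t s V) f‖ ≤ B₀w * ‖f‖)
    (hWw : ∀ r K t s, ∀ V, Prop4Hyp (W𝒱w r K t s V) C₄w a₃w) (hB₀w : 0 < B₀w) (hC₄w : 0 ≤ C₄w) (hε₄w : 0 ≤ ε₄w)
    (hdomw : 2 * (ε₄w + B₀w * bw) ≤ a₃w) (hselfw : B₀w * C₄w * (ε₄w + B₀w * bw) ^ 2 ≤ ε₄w)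
    (hcontrw : 4 * B₀w * C₄w * (ε₄w + B₀w * bw) < 1) (hH₁w : ∀ r K t s, ∀ V B, ‖kerOp (kH₁ r K t s V) B‖ ≤ B₀w * ‖B‖)
    (Φw : ∀ r K (t : ℝ) s, GaugeField (P r K s) (jl r K s) SU2 → (Fin (m₀ r K s) → ℂ) → (Λb r K s → 𝔇 r K s)) {rΦw : ℝ}
    (hΦdw : ∀ r K t s, ∀ V, DifferentiableOn ℂ (Φw r K t s V) (ball 0 rΦw)) (hΦ0w : ∀ r K t s, ∀ V, Φw r K t s V 0 = 0)
    (hΦbw : ∀ r K t s, ∀ V, ∀ z ∈ ball (0 : Fin (m₀ r K s) → ℂ) rΦw, ‖Φw r K t s V z‖ < bw) (h2Sw : 2 * S ≤ rΦw)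
    (Cw : ∀ r K (t : ℝ) s, GaugeField (P r K s) (jl r K s) SU2 → (Λw' r K s → 𝔄' r K s) → (Λx r K s → 𝔅 r K s)) {C₂w RCw : ℝ}
    (hC₂w : 0 ≤ C₂w) (hCqw : ∀ r K t s, ∀ V, ∀ Z : Λw' r K s → 𝔄' r K s, ‖Z‖ < RCw → ‖Cw r K t s V Z‖ ≤ C₂w * ‖Z‖ ^ 2)
    (hCdw : ∀ r K t s, ∀ V, DifferentiableOn ℂ (Cw r K t s V) (ball 0 RCw))
    (hιw : ∀ r K t s, ∀ V Y, ‖kerOp (kι r K t s V) Y‖ ≤ ‖Y‖) (hHw : ∀ r K t s, ∀ V X, ‖kerOp (kH r K t s V) X‖ ≤ B₀w * ‖X‖)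
    (hqw : 9 * C₂w * B₀w * (ε₄w + B₀w * bw) < 1) (hRCw : 6 * (ε₄w + B₀w * bw) ≤ RCw)
    (NW : ∀ r K (t : ℝ) s, Λz r K s → Λw r K s → Prop)
    (hlocW : ∀ r K t s, ∀ V, ∀ A A' : Λw r K s → 𝔄w r K s, ∀ c', (∀ b', NW r K t s c' b' → A b' = A' b') → W𝒱w r K t s V A c' =
      W𝒱w r K t s V A' c')
    {rW : ℝ} (hreachW : ∀ r K t s, ∀ c' b', NW r K t s c' b' → ϖw r K t s (posz r K t s c') - rW ≤ ϖw r K t s (pos r K t s b'))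
    (NC : ∀ r K (t : ℝ) s, Λx r K s → Λw' r K s → Prop)
    (hlocC : ∀ r K t s, ∀ V, ∀ A A' : Λw' r K s → 𝔄' r K s, ∀ c', (∀ b', NC r K t s c' b' → A b' = A' b') → Cw r K t s V A c' =
      Cw r K t s V A' c')
    {rC : ℝ} (hreachC : ∀ r K t s, ∀ c' b', NC r K t s c' b' → ϖw r K t s (posx r K t s c') - rC ≤ ϖw r K t s (pos' r K t s b'))
    (hsupp : ∀ r K t s, ∀ V, ∀ z : Fin (m₀ r K s) → ℂ, ∀ i, 0 < ϖw r K t s (posb r K t s i) → Φw r K t s V z i = 0)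
    (hqW : c𝒢 * M𝒢 * (2 * C₄w * a₃w * Real.exp (δw * rW)) < 1)
    (hk : 2 * C₂w * RCw * Real.exp (δw * rC) * (cι * Mι) * (cH * MH) < 1)
    {𝔭 : Bool → ℕ → σ → Type*} (Pw : ∀ r K (t : ℝ) s, Finset (𝔭 r K s))
    (ℓw : ∀ r K (t : ℝ) s, 𝔭 r K s → List ((Λw r K s → 𝔄w r K s) →L[ℂ] Matrix n n ℂ))
    (suppw : ∀ r K (t : ℝ) s, 𝔭 r K s → Finset (Λw r K s)) (ϖPw : ∀ r K (t : ℝ) s, 𝔭 r K s → ℝ)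
    (hblindw : ∀ r K t s, ∀ p ∈ Pw r K t s, ∀ ℓ ∈ ℓw r K t s p, ∀ A A' : Λw r K s → 𝔄w r K s, (∀ b' ∈ suppw r K t s p, A b' = A'
      b') → ℓ A = ℓ A')
    (hdepthw : ∀ r K t s, ∀ p ∈ Pw r K t s, ∀ b' ∈ suppw r K t s p, ϖPw r K t s p ≤ ϖw r K t s (pos r K t s b'))
    (hϖPw : ∀ r K t s, ∀ p ∈ Pw r K t s, 0 ≤ ϖPw r K t s p) {κwb κcb : ℝ} (hκwb : 0 ≤ κwb) (hκcb : 0 ≤ κcb)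
    (hℓwb : ∀ r K t s, ∀ p ∈ Pw r K t s, ∀ ℓ ∈ ℓw r K t s p, ‖ℓ‖ ≤ κwb)
    (hcurlw : ∀ r K t s, ∀ p ∈ Pw r K t s, ‖(ℓw r K t s p).sum‖ ≤ κcb) {mw : ℕ}
    (hlenw : ∀ r K t s, ∀ p ∈ Pw r K t s, (ℓw r K t s p).length ≤ mw)
    (𝓡𝒴w : ∀ r K (t : ℝ) s, AddSubgroup (Λw r K s → 𝔄w r K s))
    (h𝓡𝒴w : ∀ r K t s, IsClosed (𝓡𝒴w r K t s : Set (Λw r K s → 𝔄w r K s)))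
    (𝓡𝒵w : ∀ r K (t : ℝ) s, AddSubgroup (Λz r K s → ℭ r K s)) (𝓡𝒴w' : ∀ r K (t : ℝ) s, AddSubgroup (Λw' r K s → 𝔄' r K s))
    (𝓡𝒳w : ∀ r K (t : ℝ) s, AddSubgroup (Λx r K s → 𝔅 r K s))
    (h𝓡𝒳w : ∀ r K t s, IsClosed (𝓡𝒳w r K t s : Set (Λx r K s → 𝔅 r K s)))
    (𝓡ℬw : ∀ r K (t : ℝ) s, AddSubgroup (Λb r K s → 𝔇 r K s))
    (h𝒢rw : ∀ r K t s, ∀ V, ∀ f ∈ 𝓡𝒵w r K t s, kerOp (k𝒢 r K t s V) f ∈ 𝓡𝒴w r K t s)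
    (hWrw : ∀ r K t s, ∀ V, ∀ Y ∈ 𝓡𝒴w r K t s, W𝒱w r K t s V Y ∈ 𝓡𝒵w r K t s)
    (hιrw : ∀ r K t s, ∀ V, ∀ Y ∈ 𝓡𝒴w r K t s, kerOp (kι r K t s V) Y ∈ 𝓡𝒴w' r K t s)
    (hHrw : ∀ r K t s, ∀ V, ∀ X ∈ 𝓡𝒳w r K t s, kerOp (kH r K t s V) X ∈ 𝓡𝒴w r K t s)
    (hCrw : ∀ r K t s, ∀ V, ∀ Z ∈ 𝓡𝒴w' r K t s, Cw r K t s V Z ∈ 𝓡𝒳w r K t s)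
    (hH₁rw : ∀ r K t s, ∀ V, ∀ B ∈ 𝓡ℬw r K t s, kerOp (kH₁ r K t s V) B ∈ 𝓡𝒴w r K t s)
    (hΦrw : ∀ r K t s, ∀ V, ∀ y : Fin (m₀ r K s) → ℝ, ‖y‖ ≤ S → Φw r K t s V (cplx y) ∈ 𝓡ℬw r K t s)
    (hskew : ∀ r K t s, ∀ p ∈ Pw r K t s, ∀ ℓ ∈ ℓw r K t s p, ∀ Y ∈ 𝓡𝒴w r K t s, ℓ Y ∈ skewAdjoint (Matrix n n ℂ))
    (Bp : ∀ r K (t : ℝ) s, GaugeField (P r K s) (jl r K s) SU2 → 𝔭 r K s → Matrix n n ℂ) {d : ∀ r K (t : ℝ) s, 𝔭 r K s → ℝ}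
    {dbar : ℝ} (hBu : ∀ r K t s, ∀ V, ∀ p ∈ Pw r K t s, Bp r K t s V p ∈ unitary (Matrix n n ℂ))
    (hBd : ∀ r K t s, ∀ V, ∀ p ∈ Pw r K t s, ‖Bp r K t s V p - 1‖ ≤ d r K t s p)
    (hd : ∀ r K t s, ∀ p ∈ Pw r K t s, d r K t s p ≤ dbar) (hdbar : 0 ≤ dbar) {Kw : ℝ}
    (hKw : ∀ r K t s, ∑ p ∈ Pw r K t s, Real.exp (-(δw * ϖPw r K t s p)) ≤ Kw)
    {Λe : Bool → ℕ → σ → Type*} [∀ r K s, Fintype (Λe r K s)] {𝔄 : Bool → ℕ → σ → Type*} [∀ r K s, NormedAddCommGroup (𝔄 r K s)]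
    [∀ r K s, NormedSpace ℂ (𝔄 r K s)] [∀ r K s, CompleteSpace (𝔄 r K s)] {δ' : ℝ} {ϖ : ∀ r K (t : ℝ) s, Λe r K s → ℝ}
    (hδ' : 0 ≤ δ') (hϖ : ∀ r K t s, ∀ b', 0 ≤ ϖ r K t s b') {𝒴e' 𝒳e 𝒵e ℬe : Bool → ℕ → σ → Type*}
    [∀ r K s, NormedAddCommGroup (𝒴e' r K s)] [∀ r K s, NormedSpace ℂ (𝒴e' r K s)] [∀ r K s, NormedAddCommGroup (𝒳e r K s)]
    [∀ r K s, NormedSpace ℂ (𝒳e r K s)] [∀ r K s, CompleteSpace (𝒳e r K s)] [∀ r K s, NormedAddCommGroup (𝒵e r K s)]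
    [∀ r K s, NormedSpace ℂ (𝒵e r K s)] [∀ r K s, NormedAddCommGroup (ℬe r K s)] [∀ r K s, NormedSpace ℂ (ℬe r K s)]
    (𝒢e : ∀ r K t s, GaugeField (P r K s) (jl r K s) SU2 → (𝒵e r K s →L[ℂ] WSup (pinW δ' (ϖ r K t s)) 1 (𝔄 r K s)))
    (W𝒱e : ∀ r K t s, GaugeField (P r K s) (jl r K s) SU2 → WSup (pinW δ' (ϖ r K t s)) 1 (𝔄 r K s) → 𝒵e r K s)
    {B₀e C₄e a₃e be ε₄e : ℝ} (h𝒢e : ∀ r K t s, ∀ V f, ‖𝒢e r K t s V f‖ ≤ B₀e * ‖f‖)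
    (hWe : ∀ r K t s, ∀ V, Prop4Hyp (W𝒱e r K t s V) C₄e a₃e) (hB₀e : 0 < B₀e) (hC₄e : 0 ≤ C₄e) (hbe : 0 ≤ be) (hε₄e : 0 ≤ ε₄e)
    (hdome : 2 * (ε₄e + B₀e * be) ≤ a₃e) (hselfe : B₀e * C₄e * (ε₄e + B₀e * be) ^ 2 ≤ ε₄e)
    (hcontre : 4 * B₀e * C₄e * (ε₄e + B₀e * be) < 1)
    (H₁e : ∀ r K t s, GaugeField (P r K s) (jl r K s) SU2 → (ℬe r K s →L[ℂ] WSup (pinW δ' (ϖ r K t s)) 1 (𝔄 r K s)))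
    (hH₁e : ∀ r K t s, ∀ V B, ‖H₁e r K t s V B‖ ≤ B₀e * ‖B‖)
    (Φe : ∀ r K (t : ℝ) s, GaugeField (P r K s) (jl r K s) SU2 → (Fin (m₀ r K s) → ℂ) → ℬe r K s) {rΦe : ℝ}
    (hΦde : ∀ r K t s, ∀ V, DifferentiableOn ℂ (Φe r K t s V) (ball 0 rΦe)) (hΦ0e : ∀ r K t s, ∀ V, Φe r K t s V 0 = 0)
    (hΦbe : ∀ r K t s, ∀ V, ∀ z ∈ ball (0 : Fin (m₀ r K s) → ℂ) rΦe, ‖Φe r K t s V z‖ < be) (hSre : S < rΦe)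
    (Ce : ∀ r K (t : ℝ) s, GaugeField (P r K s) (jl r K s) SU2 → 𝒴e' r K s → 𝒳e r K s) {C₂e RCe : ℝ} (hC₂e : 0 ≤ C₂e)
    (hCqe : ∀ r K t s, ∀ V, ∀ Z : 𝒴e' r K s, ‖Z‖ < RCe → ‖Ce r K t s V Z‖ ≤ C₂e * ‖Z‖ ^ 2)
    (hCde : ∀ r K t s, ∀ V, DifferentiableOn ℂ (Ce r K t s V) (ball 0 RCe))
    (ιe : ∀ r K t s, GaugeField (P r K s) (jl r K s) SU2 → (WSup (pinW δ' (ϖ r K t s)) 1 (𝔄 r K s) →L[ℂ] (𝒴e' r K s)))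
    (hιe : ∀ r K t s, ∀ V Y, ‖ιe r K t s V Y‖ ≤ ‖Y‖)
    (He : ∀ r K t s, GaugeField (P r K s) (jl r K s) SU2 → (𝒳e r K s →L[ℂ] WSup (pinW δ' (ϖ r K t s)) 1 (𝔄 r K s)))
    (hHe : ∀ r K t s, ∀ V X, ‖He r K t s V X‖ ≤ B₀e * ‖X‖) (hqe : 9 * C₂e * B₀e * (ε₄e + B₀e * be) < 1)
    (hRCe : 3 * (ε₄e + B₀e * be) ≤ RCe) {𝔱 : Bool → ℕ → σ → Type*} (I : ∀ r K (t : ℝ) s, Finset (𝔱 r K s))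
    {Ef : ∀ r K (t : ℝ) s, 𝔱 r K s → (Λe r K s → 𝔄 r K s) → ℂ} {rE : ℝ} {ee : ∀ r K (t : ℝ) s, 𝔱 r K s → ℝ} (hrE : 0 < rE)
    (hEd : ∀ r K t s, ∀ i ∈ I r K t s, DifferentiableOn ℂ (Ef r K t s i) (ball 0 rE))
    (hEb : ∀ r K t s, ∀ i ∈ I r K t s, ∀ Z ∈ ball (0 : Λe r K s → 𝔄 r K s) rE, ‖Ef r K t s i Z‖ ≤ ee r K t s i)
    (he0 : ∀ r K t s, ∀ i ∈ I r K t s, 0 ≤ ee r K t s i) (supp : ∀ r K (t : ℝ) s, 𝔱 r K s → Finset (Λe r K s))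
    (hblind : ∀ r K t s, ∀ i ∈ I r K t s, ∀ A₁ A₂ : Λe r K s → 𝔄 r K s, (∀ b' ∈ supp r K t s i, A₁ b' = A₂ b') → Ef r K t s i A₁
      = Ef r K t s i A₂)
    (ϖP : ∀ r K (t : ℝ) s, 𝔱 r K s → ℝ)
    (hdepth : ∀ r K t s, ∀ i ∈ I r K t s, ∀ b' ∈ supp r K t s i, ϖP r K t s i ≤ ϖ r K t s b') {LK : ℝ} (hLK : 0 ≤ LK)
    (hK : ∀ r K t s, ∑ i ∈ I r K t s, 2 * ee r K t s i / rE * Real.exp (-(δ' * ϖP r K t s i)) ≤ LK)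
    (hcoupE : ((ε₄e + B₀e * be) + B₀e * (4 * C₂e * (ε₄e + B₀e * be) ^ 2)) ≤ rE / 2) {BE₁ : ℝ}
    (hElb₁ : ∀ r K t s, ∀ V (y : Fin (m₀ r K s) → ℝ), ‖y‖ ≤ S → -BE₁ ≤ (∑ i ∈ I r K t s, Ef r K t s i (WSup.toPiL (𝔄 := 𝔄 r K s)
      (pinW δ' (ϖ r K t s)) 1 (landauExp (Ce r K t s V) (ιe r K t s V) (He r K t s V) (4 * C₂e * (ε₄e + B₀e * be) ^ 2) (solAt
      (𝒢e r K t s V) 0 (W𝒱e r K t s V) ε₄e (0 : 𝒵e r K s) (H₁e r K t s V (Φe r K t s V (cplx y))) + H₁e r K t s V (Φe r K t s V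
      (cplx y)))))).re)
    {Ω : Bool → ℕ → σ → Type*} [∀ r K s, MeasurableSpace (Ω r K s)] (μ : ∀ r K (t : ℝ) s, Measure (Ω r K s))
    {g : ∀ r K (t : ℝ) s, Ω r K s → ℝ} (hg : ∀ r K t s, ∀ ω, 0 ≤ g r K t s ω)
    (Aex : ∀ r K (t : ℝ) s, GaugeField (P r K s) (jl r K s) SU2 → (Fin (m₀ r K s) → ℝ) → Ω r K s → ℝ) {Bd : ℝ} (hBd0 : 0 ≤ Bd)
    (hint : ∀ r K t s, ∀ V, ∀ x ∈ W r K t s V, ∀ c : ℝ, 1 / 2 ≤ c → c ≤ 1 → Integrable (fun ω => g r K t s ω * Real.exp (Aex r K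
      t s V (c • x) ω)) (μ r K t s))
    (hpos : ∀ r K t s, ∀ V, ∀ x ∈ W r K t s V, ∀ c : ℝ, 1 / 2 ≤ c → c ≤ 1 → 0 < ∫ ω, g r K t s ω * Real.exp (Aex r K t s V (c •
      x) ω) ∂(μ r K t s))
    (hA : ∀ r K t s, ∀ V, ∀ x ∈ W r K t s V, ∀ c : ℝ, 1 / 2 ≤ c → c ≤ 1 → ∀ ω, Aex r K t s V x ω ≤ Aex r K t s V (c • x) ω + (1
      - c) * Bd)
    {BE₂ : ℝ}
    (hElb₂ : ∀ r K t s, ∀ V (y : Fin (m₀ r K s) → ℝ), ‖y‖ ≤ S → -BE₂ ≤ (-Real.log (∫ ω, g r K t s ω * Real.exp (Aex r K t s V y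
      ω) ∂(μ r K t s))))
    (L : ∀ r K (t : ℝ) s, Set (𝒴 r K s →L[ℂ] Matrix n n ℂ)) (𝓡𝒵 : ∀ r K (t : ℝ) s, AddSubgroup (𝒵 r K s))
    (𝓡𝒴' : ∀ r K (t : ℝ) s, AddSubgroup (𝒴' r K s)) (𝓡𝒳 : ∀ r K (t : ℝ) s, AddSubgroup (𝒳 r K s))
    (h𝓡𝒳 : ∀ r K t s, IsClosed (𝓡𝒳 r K t s : Set (𝒳 r K s))) (𝓡ℬ : ∀ r K (t : ℝ) s, AddSubgroup (ℬ r K s))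
    (h𝒢r : ∀ r K t s, ∀ V, ∀ f ∈ 𝓡𝒵 r K t s, 𝒢 r K t s V f ∈ readOutReal (L r K t s))
    (hWr : ∀ r K t s, ∀ V, ∀ Y ∈ readOutReal (L r K t s), W𝒱 r K t s V Y ∈ 𝓡𝒵 r K t s)
    (hιr : ∀ r K t s, ∀ V, ∀ Y ∈ readOutReal (L r K t s), ιs r K t s V Y ∈ 𝓡𝒴' r K t s)
    (hHr : ∀ r K t s, ∀ V, ∀ X ∈ 𝓡𝒳 r K t s, Hop r K t s V X ∈ readOutReal (L r K t s))
    (hCr : ∀ r K t s, ∀ V, ∀ Z ∈ 𝓡𝒴' r K t s, Cf r K t s V Z ∈ 𝓡𝒳 r K t s)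
    (hH₁r : ∀ r K t s, ∀ V, ∀ B ∈ 𝓡ℬ r K t s, H₁ r K t s V B ∈ readOutReal (L r K t s))
    (hΦr : ∀ r K t s, ∀ V, ∀ y : Fin (m₀ r K s) → ℝ, ‖y‖ ≤ S → Φ r K t s V (cplx y) ∈ 𝓡ℬ r K t s)
    (hRdict : ∀ r K t s, ∀ V, ∀ x ∈ cube (m₀ r K s) S, F r K t s (fixTo (Tr r K s) (U₀ r K t s) (updateFinset V (Λ r K s)
      (expFibreChart (Λ r K s) (ctr r K t s V) (e r K s) x))) = Jco r K t s V x * ENNReal.ofReal (Real.exp (-((∑ p ∈ Pw r K t s,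
      β r (jl r K s) * (1 - (Matrix.trace (Bp r K t s V p * holOf (ℓw r K t s p) (fun y => landauExp (Cw r K t s V) (kerOp (kι r
      K t s V)) (kerOp (kH r K t s V)) (4 * C₂w * (ε₄w + B₀w * bw) ^ 2) (solAt (kerOp (k𝒢 r K t s V)) 0 (W𝒱w r K t s V) ε₄w (0 :
      Λz r K s → ℭ r K s) (kerOp (kH₁ r K t s V) (Φw r K t s V (cplx y))) + kerOp (kH₁ r K t s V) (Φw r K t s V (cplx y))))
      x)).re / Fintype.card n)) + ((∑ i ∈ I r K t s, Ef r K t s i (WSup.toPiL (𝔄 := 𝔄 r K s) (pinW δ' (ϖ r K t s)) 1 (landauExp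
      (Ce r K t s V) (ιe r K t s V) (He r K t s V) (4 * C₂e * (ε₄e + B₀e * be) ^ 2) (solAt (𝒢e r K t s V) 0 (W𝒱e r K t s V) ε₄e
      (0 : 𝒵e r K s) (H₁e r K t s V (Φe r K t s V (cplx x))) + H₁e r K t s V (Φe r K t s V (cplx x)))))).re + (-Real.log (∫ ω, g
      r K t s ω * Real.exp (Aex r K t s V x ω) ∂(μ r K t s))))))))
    (hudict : ∀ r K t s, ∀ V, ∀ x ∈ cube (m₀ r K s) S, u r K t s (fixTo (Tr r K s) (U₀ r K t s) (updateFinset V (Λ r K s)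
      (expFibreChart (Λ r K s) (ctr r K t s V) (e r K s) x))) = classifier (hPu r K t s) (fun p => holOf (ℓs r K t s p) (fun y
      => landauExp (Cf r K t s V) (ιs r K t s V) (Hop r K t s V) (4 * C₂ * (ε₄ + B₀ * (2 * dL * C₁ * ε₁)) ^ 2) (solAt (𝒢 r K t s
      V) 0 (W𝒱 r K t s V) ε₄ (0 : 𝒵 r K s) (H₁ r K t s V (Φ r K t s V (cplx y))) + H₁ r K t s V (Φ r K t s V (cplx y))))) x)
    (hJW : ∀ r K t s, ∀ V x, Jco r K t s V x ≠ 0 → x ∈ W r K t s V)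
    (hJ : ∀ r K t s, ∀ V x, ∀ a : ℝ, 0 ≤ a → Jco r K t s V x ≤ Jco r K t s V (Real.exp (-a) • x))
    (hJ1 : ∀ r K t s, ∀ V x, Jco r K t s V x ≤ 1) (hWS : ∀ r K t s, ∀ V, W r K t s V ⊆ closedBall (0 : Fin (m₀ r K s) → ℝ) S)
    (hδ0 : 0 ≤ δ) (hδ1 : δ < 1)
    {c₁ c₂ zs : ℝ}
    (hs₁ : ∀ r K s, κc * ((ε₄ + B₀ * (2 * dL * C₁ * ε₁)) + B₀ * (4 * C₂ * (ε₄ + B₀ * (2 * dL * C₁ * ε₁)) ^ 2)) ≤ c₁ * η r (jl r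
      K s) ^ 2 * zs)
    (ha : ∀ r K s, κr * ((ε₄ + B₀ * (2 * dL * C₁ * ε₁)) + B₀ * (4 * C₂ * (ε₄ + B₀ * (2 * dL * C₁ * ε₁)) ^ 2)) ≤ c₂ * η r (jl r K
      s) * zs)
    (hma : m * (κr * ((ε₄ + B₀ * (2 * dL * C₁ * ε₁)) + B₀ * (4 * C₂ * (ε₄ + B₀ * (2 * dL * C₁ * ε₁)) ^ 2))) ≤ 1)
    (hsm : ∀ r K s, 36 * (c₁ * zs + m ^ 2 * c₂ ^ 2 * zs ^ 2) / (rΦ / S - 1) ^ 2 ≤ δ * ε r (K - lvl r K s))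
    (hρ : ∀ r j, ρ r j ≤ (1 - δ) / 2) (hβ : ∀ r j, 0 ≤ β r j)
    -- the slot → level majorant: S80 f3's slot constant (written out ONCE) under the displayed level profile `D r`
    (hDslot : ∀ r K t, |t| ≤ l₀ → ∀ s ∈ Sl r K, 2 * ((m₀ r K s : ℝ) + (3 * (|β r (jl r K s)| * ((dbar + 2 * (κcb * (cH₁ * MH₁ *
      bw / ((1 - c𝒢 * M𝒢 * (2 * C₄w * a₃w * Real.exp (δw * rW))) * (1 - 2 * C₂w * RCw * Real.exp (δw * rC) * (cι * Mι) * (cH *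
      MH)))) + expTail₂ (mw * (κwb * (cH₁ * MH₁ * bw / ((1 - c𝒢 * M𝒢 * (2 * C₄w * a₃w * Real.exp (δw * rW))) * (1 - 2 * C₂w *
      RCw * Real.exp (δw * rC) * (cι * Mι) * (cH * MH))))))) / (rΦw / S)) * (2 * (κcb * (cH₁ * MH₁ * bw / ((1 - c𝒢 * M𝒢 * (2 *
      C₄w * a₃w * Real.exp (δw * rW))) * (1 - 2 * C₂w * RCw * Real.exp (δw * rC) * (cι * Mι) * (cH * MH)))) + expTail₂ (mw *
      (κwb * (cH₁ * MH₁ * bw / ((1 - c𝒢 * M𝒢 * (2 * C₄w * a₃w * Real.exp (δw * rW))) * (1 - 2 * C₂w * RCw * Real.exp (δw * rC) *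
      (cι * Mι) * (cH * MH))))))) / (rΦw / S))) * Kw) + (3 * (LK * (2 * ((ε₄e + B₀e * be) + B₀e * (4 * C₂e * (ε₄e + B₀e * be) ^
      2)))) / (rΦe / S - 1) + Bd))) / (1 - δ) ≤ D r (lvl r K s))
    -- END-I's own rows ((R)+[dict] with the NORMALISED variables, finiteness, windows, `D ≤ D̄`, rates) — S27 VERBATIM
    {ι : Type*} {T : ℕ → Finset ι} {A B shA shB : ℕ → ℝ → ι → ℝ}
    {pieceA pieceB : ℕ → ℝ → σ → ι → ℝ} {MA MB : ℕ → ℝ → σ → ℝ} {N₁ : ℕ} {νbar Dbar crate ϑ : ℝ}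
    (hFfin : ∀ r K t s, ∫⁻ U, F r K t s U ∂(fieldMeasure (P r K s) (jl r K s) SU2) ≠ ∞)
    (sh_nonnegA : ∀ K t, |t| ≤ l₀ → ∀ τ ∈ T K, 0 ≤ shA K t τ)
    (sh_leA : ∀ K t, |t| ≤ l₀ → ∀ τ ∈ T K, shA K t τ ≤ A K t τ)
    (coverA : ∀ K t, |t| ≤ l₀ → ∀ τ ∈ T K, shA K t τ ≤ ∑ s ∈ Sl true K, pieceA K t s τ)
    (hMA : ∀ K t, |t| ≤ l₀ → ∀ s ∈ Sl true K, 0 ≤ MA K t s)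
    (piece_leA : ∀ K t, |t| ≤ l₀ → ∀ s ∈ Sl true K, ∑ τ ∈ T K, pieceA K t s τ ≤ MA K t s *
      (((fieldMeasure (P true K s) (jl true K s) SU2).withDensity (F true K t s))
        {x | ε true (K - lvl true K s) * (1 - ρ true (lvl true K s)) ≤ u true K t s x / η true (jl true K s) ^ 2 ∧
          u true K t s x / η true (jl true K s) ^ 2 < ε true (K - lvl true K s)}).toReal)
    (total_geA : ∀ K t, |t| ≤ l₀ → ∀ s ∈ Sl true K,
      MA K t s * (((fieldMeasure (P true K s) (jl true K s) SU2).withDensity (F true K t s)) Set.univ).toReal ≤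
        ∑ τ ∈ T K, A K t τ)
    (sh_nonnegB : ∀ K t, |t| ≤ l₀ → ∀ τ ∈ T K, 0 ≤ shB K t τ)
    (sh_leB : ∀ K t, |t| ≤ l₀ → ∀ τ ∈ T K, shB K t τ ≤ B K t τ)
    (coverB : ∀ K t, |t| ≤ l₀ → ∀ τ ∈ T K, shB K t τ ≤ ∑ s ∈ Sl false K, pieceB K t s τ)
    (hMB : ∀ K t, |t| ≤ l₀ → ∀ s ∈ Sl false K, 0 ≤ MB K t s)
    (piece_leB : ∀ K t, |t| ≤ l₀ → ∀ s ∈ Sl false K, ∑ τ ∈ T K, pieceB K t s τ ≤ MB K t s *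
      (((fieldMeasure (P false K s) (jl false K s) SU2).withDensity (F false K t s))
        {x | ε false (K - lvl false K s) * (1 - ρ false (lvl false K s)) ≤ u false K t s x / η false (jl false K s) ^ 2 ∧
          u false K t s x / η false (jl false K s) ^ 2 < ε false (K - lvl false K s)}).toReal)
    (total_geB : ∀ K t, |t| ≤ l₀ → ∀ s ∈ Sl false K,
      MB K t s * (((fieldMeasure (P false K s) (jl false K s) SU2).withDensity (F false K t s)) Set.univ).toReal ≤
        ∑ τ ∈ T K, B K t τ)
    (hw : ∀ r, LiveWindow (Sl r) (lvl r) N₁ νbar) (hϑ0 : 0 < ϑ) (hϑ1 : ϑ < 1)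
    (hDbar : ∀ r j, D r j ≤ Dbar) (hrate : ∀ r j, ρ r j ≤ crate * ϑ ^ j) :
    ShellWeightBound l₀ T A B shA shB
      (fun K => ∑ s ∈ Sl true K, D true (lvl true K s) * ρ true (lvl true K s) +
        ∑ s ∈ Sl false K, D false (lvl false K s) * ρ false (lvl false K s)) := by
  -- file 1: END-II of record ∘ γ8 unit change, over the indexed families (both runs, every slot)
  have hlive := hac_live_of_assembled_decay P jl lvl hη hε hρ0 hT U₀ Λ e hS hSπ ctr hF hFi hFsupp hu hui hPu W Jco 𝒢 W𝒱 h𝒢 hW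
    hB₀ hC₄ hε₄ hdL hC₁ hε₁ hB₃ h1 h2 h3 H₁ hH₁ Φ hΦd hΦ0 hΦ hSr Cf hC₂ hCq hCd ιs hι Hop hH h18 hcoup h3R ℓs hκ hℓ hlen hκc
    hcurl hδw ϖw dis hϖw pos posz pos' posx posb k𝒢 kι kH kH₁ hc𝒢 hM𝒢 hk𝒢 hM𝒢' hcι hMι hkι hMι' hcH hMH hkH hMH' hcH₁ hMH₁ hkH₁
    hMH₁' W𝒱w h𝒢w hWw hB₀w hC₄w hε₄w hdomw hselfw hcontrw hH₁w Φw hΦdw hΦ0w hΦbw h2Sw Cw hC₂w hCqw hCdw hιw hHw hqw hRCw NW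
    hlocW hreachW NC hlocC hreachC hsupp hqW hk Pw ℓw suppw ϖPw hblindw hdepthw hϖPw hκwb hκcb hℓwb hcurlw hlenw 𝓡𝒴w h𝓡𝒴w 𝓡𝒵w
    𝓡𝒴w' 𝓡𝒳w h𝓡𝒳w 𝓡ℬw h𝒢rw hWrw hιrw hHrw hCrw hH₁rw hΦrw hskew Bp hBu hBd hd hdbar hKw hδ' hϖ 𝒢e W𝒱e h𝒢e hWe hB₀e hC₄e hbe hε₄e
    hdome hselfe hcontre H₁e hH₁e Φe hΦde hΦ0e hΦbe hSre Ce hC₂e hCqe hCde ιe hιe He hHe hqe hRCe I hrE hEd hEb he0 supp hblind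
    ϖP hdepth hLK hK hcoupE hElb₁ μ hg Aex hBd0 hint hpos hA hElb₂ L 𝓡𝒵 𝓡𝒴' 𝓡𝒳 h𝓡𝒳 𝓡ℬ h𝒢r hWr hιr hHr hCr hH₁r hΦr hRdict hudict
    hJW hJ hJ1 hWS hδ0 hδ1 hs₁ ha hma hsm hρ hβ
  -- END-I (S27 §2: slot towers, age thresholds) with `hacA`∕`hacB` DISCHARGED by `hlive true` ∕ `hlive false`
  exact shellWeightBound_of_towerData_sync (G := SU2) (PA := P true) (jA := jl true) (PB := P false) (jB := jl false)
    (θA := fun K s => ε true (K - lvl true K s)) (θB := fun K s => ε false (K - lvl false K s))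
    (uA := fun K t s U => u true K t s U / η true (jl true K s) ^ 2)
    (uB := fun K t s U => u false K t s U / η false (jl false K s) ^ 2)
    (hFfin true) sh_nonnegA sh_leA coverA hMA piece_leA total_geA (hD0 true) (hρ0 true) (hDslot true)
    (fun K t _ s _ => hlive true K t s)
    (hFfin false) sh_nonnegB sh_leB coverB hMB piece_leB total_geB (hD0 false) (hρ0 false) (hDslot false)
    (fun K t _ s _ => hlive false K t s)
    (hw true) (hw false) hϑ0 hϑ1 (hDbar true) (hDbar false) (hrate true) (hrate false)

end Summit.QuantumFields.BalabanUV.T4Continuum.ShellMeasureLiveEndOneCall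

end
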